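import Mathlib
import Literature.AlgebraicGeometry.Resolution.WeightedInitialForms
import Literature.AlgebraicGeometry.Resolution.PolygonInvariants
import Literature.AlgebraicGeometry.Resolution.WeightedIdealCoordinateChanges
import HarnessLib

/-!
# Dissolution of a solvable vertex of the characteristic polygon

Topic: `Literature/AlgebraicGeometry/Resolution`. Hironaka's vertex preparation for the
polygon `Δ(J; u₁, u₂; y)` of an idealistic exponent `(J, μ)` in a regular local ring of
dimension `3` (Cossart–Piltant 2008, §4, p. 11: "if a vertex `v = (v₁, v₂)` is solvable, change
`y` to `y + λ_v u₁^{v₁} u₂^{v₂}` and note that `(α + β, α)_lex` increases"; Cossart–Jannsen–Saito,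
LNM 2270, Theorem 8.16 / Lemma 11.4 (1): dissolution at a vertex other than `v` preserves
`v = (α, β)` and `β`). For the coordinate change `c′ = (y + λ u₁^{v₁} u₂^{v₂}, u₁, u₂)` at an
integral point `v` of the polygon realised by a Newton point `e_v`, PROVED (no facts):

* `forall_pts_shiftZ_of_forall_pts` — **the polygon does not grow**: every half-plane
  `p₁ x₁ + p₂ x₂ ≥ w₀` containing `pts c J μ` contains `pts c′ J μ`
  (`Δ(J; u; y′) ⊆ Δ(J; u; y)`, CJS Thm. 8.16);
* `lt_of_mem_pts_shiftZ_of_isSolvableAt` — **the solvable vertex is dissolved**: if the initial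
  forms of `J` along a supporting line through `v` are all multiples of `(Y + λ U^v)^μ` and
  `λ` is the residue of the shift coefficient, then NO Newton point of `c′` of `y`-degree `< μ`
  lies on that line (CoP1 p. 11; CJS Thm. 8.16 (2));
* `mem_pts_shiftZ_of_isMinOn` — **vertices strictly on the near side of a supporting line are
  preserved** (CJS Lemma 11.4 (1): `v(f, z, u) = v(f, y, u)` when dissolving a vertex with
  `a₁ > α`): a minimiser `e⋆` of `p₁′ x₁ + p₂′ x₂` over `pts c J μ` with
  `p₁′ v₁ + p₂′ v₂ > ℓ′(e⋆)/L` stays a Newton point of `c′`.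

## Sources

* V. Cossart, O. Piltant, J. Algebra 320 (2008), §4, p. 11 (solvable vertices, preparation).
  [CossartPiltant2008]
* V. Cossart, U. Jannsen, S. Saito, LNM 2270 (2020), Thm. 8.16, Lemma 11.4 (1), Def. 8.11.
  [CossartJannsenSaito2020]
* H. Hironaka, J. Math. Kyoto Univ. 7 (1967), §3 (vertex preparation). [Hironaka1967]
-/

noncomputable section

open IsLocalRing MvPolynomial

namespace Literature.AlgebraicGeometry.Resolution

universe u

variable {R : Type u} [CommRing R]

/-! ## The coordinate change `y ↦ y + t` -/

/-- The system `(y + t, u₁, u₂)`. [cite: CossartPiltant2008, §4 p. 11] -/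
def shiftZ (c : Fin 3 → R) (t : R) : Fin 3 → R := ![c 0 + t, c 1, c 2]

/-- Component / bookkeeping lemma. [folklore] -/
@[simp] theorem shiftZ_zero (c : Fin 3 → R) (t : R) : shiftZ c t 0 = c 0 + t := rfl
/-- Component / bookkeeping lemma. [folklore] -/
@[simp] theorem shiftZ_one (c : Fin 3 → R) (t : R) : shiftZ c t 1 = c 1 := rfl
/-- Component / bookkeeping lemma. [folklore] -/
@[simp] theorem shiftZ_two (c : Fin 3 → R) (t : R) : shiftZ c t 2 = c 2 := rfl

/-- `![c 0, c 1, c 2] = c`. [folklore] -/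
theorem eta_fin_three {α : Type*} (c : Fin 3 → α) : ![c 0, c 1, c 2] = c := by
  funext i; fin_cases i <;> rfl

/-- Shifting back: `shiftZ (shiftZ c t) (−t) = c`. [folklore] -/
theorem shiftZ_shiftZ_neg (c : Fin 3 → R) (t : R) : shiftZ (shiftZ c t) (-t) = c := by
  funext i; fin_cases i <;> simp [shiftZ]

/-- The shift monomial `λ u₁^{v₁} u₂^{v₂}`. [cite: CossartPiltant2008, §4 p. 11] -/
def shiftMon (c : Fin 3 → R) (lam : R) (v₁ v₂ : ℕ) : R := lam * (c 1 ^ v₁ * c 2 ^ v₂)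

/-- The exponent `(0, v₁, v₂)` of the shift monomial. [folklore] -/
def vexp (v₁ v₂ : ℕ) : Fin 3 →₀ ℕ := Finsupp.single 1 v₁ + Finsupp.single 2 v₂

/-- Component / bookkeeping lemma. [folklore] -/
@[simp] theorem vexp_zero (v₁ v₂ : ℕ) : vexp v₁ v₂ 0 = 0 := by simp [vexp]
/-- Component / bookkeeping lemma. [folklore] -/
@[simp] theorem vexp_one (v₁ v₂ : ℕ) : vexp v₁ v₂ 1 = v₁ := by simp [vexp]
/-- Component / bookkeeping lemma. [folklore] -/
@[simp] theorem vexp_two (v₁ v₂ : ℕ) : vexp v₁ v₂ 2 = v₂ := by simp [vexp]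

/-- The weight of `vexp`. [folklore] -/
theorem weight_vexp (W : Fin 3 → ℕ) (v₁ v₂ : ℕ) :
    Finsupp.weight W (vexp v₁ v₂) = v₁ * W 1 + v₂ * W 2 := by
  rw [Finsupp.weight_apply, Finsupp.sum_fintype _ _ (by simp)]
  simp [Fin.sum_univ_three, mul_comm]

/-- `monom3 c (vexp v₁ v₂) = u₁^{v₁} u₂^{v₂}`. [folklore] -/
theorem monom3_vexp (c : Fin 3 → R) (v₁ v₂ : ℕ) : monom3 c (vexp v₁ v₂) = c 1 ^ v₁ * c 2 ^ v₂ := by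
  simp [monom3]

/-- The shift monomial does not involve `y`: `shiftMon (shiftZ c t) = shiftMon c`. [folklore] -/
theorem shiftMon_shiftZ (c : Fin 3 → R) (t lam : R) (v₁ v₂ : ℕ) :
    shiftMon (shiftZ c t) lam v₁ v₂ = shiftMon c lam v₁ v₂ := rfl

/-- **Dissolution invariance of the weighted order ideals**: `F^{W}_ρ(y + t, u) = F^{W}_ρ(y, u)`
for `t = λ u₁^{v₁} u₂^{v₂}` with `v₁ W₁ + v₂ W₂ ≥ W₀`. [cite: CossartPiltant2008, §4 p. 11] -/
theorem weightedIdealW_shiftZ (c : Fin 3 → R) (lam : R) {v₁ v₂ : ℕ} (W : Fin 3 → ℕ)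
    (hW : W 0 ≤ v₁ * W 1 + v₂ * W 2) (ρ : ℕ) :
    weightedIdealW (shiftZ c (shiftMon c lam v₁ v₂)) W ρ = weightedIdealW c W ρ := by
  obtain ⟨h1, h2⟩ := monomial_u_mem_weightedIdealW (c 0) (c 0 + shiftMon c lam v₁ v₂) (c 1) (c 2)
    lam W hW
  have := weightedIdealW_shift_z (c 0) (c 1) (c 2) (shiftMon c lam v₁ v₂) W h2 h1 ρ
  rw [eta_fin_three] at this
  exact this

/-- The maximal ideal is still generated (the shift lies in `(u₁, u₂)` when `v ≠ 0`).
[folklore] -/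
theorem span_triple_shiftZ (c : Fin 3 → R) (lam : R) {v₁ v₂ : ℕ} (hv : 0 < v₁ + v₂) :
    Ideal.span {shiftZ c (shiftMon c lam v₁ v₂) 0, shiftZ c (shiftMon c lam v₁ v₂) 1,
      shiftZ c (shiftMon c lam v₁ v₂) 2} = Ideal.span {c 0, c 1, c 2} := by
  have hmem : ∀ y : R, shiftMon c lam v₁ v₂ ∈ Ideal.span ({y, c 1, c 2} : Set R) := by
    intro y
    rw [shiftMon]
    refine Ideal.mul_mem_left _ _ ?_
    rcases Nat.eq_zero_or_pos v₁ with h0 | hpos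
    · have hv₂ : 0 < v₂ := by omega
      obtain ⟨k, hk⟩ : ∃ k, v₂ = k + 1 := ⟨v₂ - 1, by omega⟩
      rw [hk, pow_succ, ← mul_assoc]
      exact Ideal.mul_mem_left _ _ (Ideal.subset_span (by simp))
    · obtain ⟨k, hk⟩ : ∃ k, v₁ = k + 1 := ⟨v₁ - 1, by omega⟩
      rw [hk, pow_succ, mul_assoc, mul_comm (c 1), ← mul_assoc]
      exact Ideal.mul_mem_left _ _ (Ideal.subset_span (by simp))
  simp only [shiftZ_zero, shiftZ_one, shiftZ_two]
  apply le_antisymm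
  · rw [Ideal.span_le]
    rintro x (rfl | rfl | rfl)
    · exact Ideal.add_mem _ (Ideal.subset_span (by simp)) (hmem _)
    · exact Ideal.subset_span (by simp)
    · exact Ideal.subset_span (by simp)
  · rw [Ideal.span_le]
    rintro x (rfl | rfl | rfl)
    · have : c 0 = (c 0 + shiftMon c lam v₁ v₂) - shiftMon c lam v₁ v₂ := by ring
      rw [SetLike.mem_coe, this]
      exact Ideal.sub_mem _ (Ideal.subset_span (by simp)) (hmem _)
    · exact Ideal.subset_span (by simp)
    · exact Ideal.subset_span (by simp)

section Regular

variable [IsRegularLocalRing R] (c : Fin 3 → R)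
  (hgen : Ideal.span {c 0, c 1, c 2} = maximalIdeal R) (hdim : ringKrullDim R = 3)
  {J : Ideal R} {μ : ℕ} (lam : R) {v₁ v₂ : ℕ}

local notation "c'" => shiftZ c (shiftMon c lam v₁ v₂)

include hgen hdim in
/-- **The polygon does not grow under dissolution at a point of the polygon**: if the integral
point `v` is realised by `e_v ∈ pts c J μ` (`spt e_v = L v`), then every half-plane
`p₁ x₁ + p₂ x₂ ≥ w₀` (`w₀, p₁, p₂ > 0`) containing `pts c J μ` contains `pts c′ J μ`.
[cite: CossartJannsenSaito2020, Thm. 8.16] [cite: CossartPiltant2008, §4 p. 11] -/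
theorem forall_pts_shiftZ_of_forall_pts (hv : 0 < v₁ + v₂) {e_v : Fin 3 →₀ ℕ}
    (hev : e_v ∈ pts c J μ) (hev₁ : spt₁ μ e_v = μ.factorial * v₁)
    (hev₂ : spt₂ μ e_v = μ.factorial * v₂) {w₀ p₁ p₂ : ℕ} (hw₀ : 0 < w₀) (hp₁ : 0 < p₁)
    (hp₂ : 0 < p₂) (hS : ∀ e ∈ pts c J μ, w₀ ≤ p₁ * spt₁ μ e + p₂ * spt₂ μ e) :
    ∀ e ∈ pts c' J μ, w₀ ≤ p₁ * spt₁ μ e + p₂ * spt₂ μ e := by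
  have hJ := (le_weightedIdealW_levelWeight_iff c hgen hdim J hw₀ hp₁ hp₂).mpr hS
  have hgen' : Ideal.span {c' 0, c' 1, c' 2} = maximalIdeal R := by
    rw [span_triple_shiftZ c lam hv]; exact hgen
  have hW : levelWeight μ w₀ p₁ p₂ 0 ≤ v₁ * levelWeight μ w₀ p₁ p₂ 1 + v₂ * levelWeight μ w₀ p₁ p₂ 2 := by
    have := hS e_v hev
    rw [hev₁, hev₂] at this
    simp only [levelWeight_zero, levelWeight_one, levelWeight_two]
    nlinarith [this]
  rw [← weightedIdealW_shiftZ c lam (levelWeight μ w₀ p₁ p₂) hW] at hJ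
  exact (le_weightedIdealW_levelWeight_iff c' hgen' hdim J hw₀ hp₁ hp₂).mp hJ

omit [IsRegularLocalRing R] in
/-- A `w`-homogeneous polynomial with coefficients in `𝔪` evaluates into `F_{n+1}` (triple
generation form). [folklore] -/
theorem eval_mem_succ_of_coeff_mem' [IsLocalRing R] (hgen : Ideal.span {c 0, c 1, c 2} = maximalIdeal R)
    {w : Fin 3 → ℕ} (hw : ∀ i, 0 < w i) {n : ℕ} {F : MvPolynomial (Fin 3) R}
    (hF : F.IsWeightedHomogeneous w n) (hc : ∀ m, F.coeff m ∈ maximalIdeal R) :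
    eval c F ∈ weightedIdealW c w (n + 1) :=
  eval_mem_succ_of_coeff_mem c (span_range_eq_of_span_triple c hgen) hw hF hc

include hgen hdim in
/-- **The solvable vertex is dissolved**: let `w = (w₀, L p₁, L p₂)` be a level weight whose line
`p₁ x₁ + p₂ x₂ = w₀` passes through the integral point `v` (`w₀ = L (p₁ v₁ + p₂ v₂)`) realised
by `e_v`, and contains `pts c J μ` in its half-plane. If all initial forms of `J` in degree
`w₀ μ` are multiples of `(Y + λ̄ U^v)^μ` (`IsSolvableAt`) and `t = λ u^v` with `λ̄` the residue
of `λ`, then after `y ↦ y + t` no Newton point of `y`-degree `< μ` lies on the line.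
[cite: CossartPiltant2008, §4 p. 11] [cite: CossartJannsenSaito2020, Thm. 8.16] -/
theorem lt_of_mem_pts_shiftZ_of_isSolvableAt (hv : 0 < v₁ + v₂) {e_v : Fin 3 →₀ ℕ}
    (hev : e_v ∈ pts c J μ) (hev₁ : spt₁ μ e_v = μ.factorial * v₁)
    (hev₂ : spt₂ μ e_v = μ.factorial * v₂) {w₀ p₁ p₂ : ℕ} (hw₀ : 0 < w₀) (hp₁ : 0 < p₁)
    (hp₂ : 0 < p₂) (hline : w₀ = μ.factorial * (p₁ * v₁ + p₂ * v₂))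
    (hS : ∀ e ∈ pts c J μ, w₀ ≤ p₁ * spt₁ μ e + p₂ * spt₂ μ e)
    (hsolv : IsSolvableAt c J (levelWeight μ w₀ p₁ p₂) (w₀ * μ) μ (vexp v₁ v₂) (residue R lam)) :
    ∀ e ∈ pts c' J μ, w₀ < p₁ * spt₁ μ e + p₂ * spt₂ μ e := by
  classical
  set w := levelWeight μ w₀ p₁ p₂ with hwdef
  have hw : ∀ i, 0 < w i := levelWeight_pos hw₀ hp₁ hp₂
  have hgen' : Ideal.span {c' 0, c' 1, c' 2} = maximalIdeal R := by
    rw [span_triple_shiftZ c lam hv]; exact hgen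
  have hS' := forall_pts_shiftZ_of_forall_pts c hgen hdim lam hv hev hev₁ hev₂ hw₀ hp₁ hp₂ hS
  have hWv : w 0 ≤ v₁ * w 1 + v₂ * w 2 := by
    simp only [hwdef, levelWeight_zero, levelWeight_one, levelWeight_two, hline]; nlinarith
  intro e he
  by_contra hle
  push Not at hle
  have heq : p₁ * spt₁ μ e + p₂ * spt₂ μ e = w₀ := le_antisymm hle (hS' e he)
  -- `e` minimises the form over `pts c′`, hence is a `w`-initial term of some `g ∈ J` for `c′`
  have hmin : ∀ x ∈ pts c' J μ, p₁ * spt₁ μ e + p₂ * spt₂ μ e ≤ p₁ * spt₁ μ x + p₂ * spt₂ μ x := by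
    intro x hx; rw [heq]; exact hS' x hx
  obtain ⟨g, hgJ, hinit⟩ := exists_isInitialTerm_levelWeight_of_isMinOn c' hgen' hdim hp₁ hp₂ he hmin
    (by rw [heq]; exact hw₀)
  rw [heq] at hinit
  -- the initial form of `g` for `c` is `a (Y + λ̄ U^v)^μ`
  have hgw : g ∈ weightedIdealW c w (w₀ * μ) :=
    (le_weightedIdealW_levelWeight_iff c hgen hdim J hw₀ hp₁ hp₂).mpr hS hgJ
  obtain ⟨-, hvw, hsol⟩ := hsolv
  obtain ⟨a, ha⟩ := hsol g hgJ hgw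
  obtain ⟨G, hG, hGmap, hGrem⟩ := isInForm_inForm c hgen hdim hw hgw
  obtain ⟨a', ha'⟩ := residue_surjective (R := R) a
  set Gt : MvPolynomial (Fin 3) R := C a' * (X 0 + C lam * monomial (vexp v₁ v₂) 1) ^ μ with hGt
  have hGt_hom : Gt.IsWeightedHomogeneous w (w₀ * μ) := by
    have h1 : (X 0 + C lam * monomial (vexp v₁ v₂) 1 : MvPolynomial (Fin 3) R).IsWeightedHomogeneous
        w (w 0) := by
      refine (isWeightedHomogeneous_X _ _ _).add ?_
      rw [C_mul_monomial, mul_one]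
      exact isWeightedHomogeneous_monomial _ _ _ hvw
    have h2 := h1.pow μ
    have h3 : (C a' : MvPolynomial (Fin 3) R).IsWeightedHomogeneous w 0 := isWeightedHomogeneous_C _ _
    have := h3.mul h2
    rw [zero_add, smul_eq_mul] at this
    convert this using 1
    simp only [hwdef, levelWeight_zero]; ring
  have hGt_map : MvPolynomial.map (residue R) Gt = inForm c w (w₀ * μ) g := by
    rw [ha, hGt, map_mul, map_C, ha', map_pow, map_add, map_X, map_mul, map_C, map_monomial,
      map_one]
  -- `G - Gt` has coefficients in `𝔪`, hence `g ≡ Gt(c) mod F_{w₀ μ + 1}`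
  have hdiffc : ∀ m, (G - Gt).coeff m ∈ maximalIdeal R := by
    rw [← map_residue_eq_zero_iff, map_sub, hGmap, hGt_map, sub_self]
  have hdiff : eval c (G - Gt) ∈ weightedIdealW c w (w₀ * μ + 1) :=
    eval_mem_succ_of_coeff_mem' c hgen hw (isWeightedHomogeneous_sub hG hGt_hom) hdiffc
  have hgGt : g - eval c Gt ∈ weightedIdealW c w (w₀ * μ + 1) := by
    have : g - eval c Gt = (g - eval c G) + eval c (G - Gt) := by rw [map_sub]; ring
    rw [this]; exact Ideal.add_mem _ hGrem hdiff
  -- `Gt(c) = a′ (c′ 0)^μ`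
  have hGt_eval : eval c Gt = a' * (c' 0) ^ μ := by
    rw [hGt, map_mul, eval_C, map_pow, map_add, eval_X, map_mul, eval_C, eval_monomial_eq_monom3,
      one_mul, monom3_vexp, shiftZ_zero, shiftMon]
  -- hence the initial form of `g` for `c′` is `ā Y^μ`
  have hIn' : IsInForm c' w (w₀ * μ) g (C a * X 0 ^ μ) := by
    refine ⟨C a' * X 0 ^ μ, ?_, ?_, ?_⟩
    · have h3 : (C a' : MvPolynomial (Fin 3) R).IsWeightedHomogeneous w 0 := isWeightedHomogeneous_C _ _
      have h2 := (isWeightedHomogeneous_X (R := R) w 0).pow μ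
      have := h3.mul h2
      rw [zero_add, smul_eq_mul] at this
      convert this using 1
      simp only [hwdef, levelWeight_zero]; ring
    · rw [map_mul, map_C, ha', map_pow, map_X]
    · rw [map_mul, eval_C, map_pow, eval_X, ← hGt_eval, ← weightedIdealW_shiftZ c lam w hWv] at *
      exact hgGt
  have hgw' : g ∈ weightedIdealW c' w (w₀ * μ) := by rw [weightedIdealW_shiftZ c lam w hWv]; exact hgw
  have hin' : inForm c' w (w₀ * μ) g = C a * X 0 ^ μ := (hIn'.eq_inForm c' hgen' hdim hw).symm
  -- `e` lies in the support of `ā Y^μ`, so `e = (μ, 0, 0)`: contradiction with `e₀ < μ`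
  have hwe : Finsupp.weight w e = w₀ * μ := by
    have := weight_levelWeight_self he.2 p₁ p₂
    rw [heq] at this; exact this
  have hsupp := (mem_support_inForm_iff c' hgen' hdim hw hgw' hwe).mpr hinit
  rw [hin', C_mul_X_pow_eq_monomial] at hsupp
  have he0 : e = Finsupp.single 0 μ := Finset.mem_singleton.mp (support_monomial_subset hsupp)
  have := he.2
  rw [he0, Finsupp.single_eq_same] at this
  exact lt_irrefl _ this

omit [IsRegularLocalRing R] in
/-- **Substitution estimate**: for `t` of `w`-weight `> w₀` and `G` homogeneous of weight `n`,
`G(y, u) − G(y + t, u) ∈ F_{n+1}`. [folklore] -/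
theorem eval_sub_eval_shiftZ_mem {w : Fin 3 → ℕ} {t : R} (ht : t ∈ weightedIdealW c w (w 0 + 1))
    (ht' : t ∈ weightedIdealW (shiftZ c t) w (w 0)) (ht'' : t ∈ weightedIdealW c w (w 0))
    {n : ℕ} {G : MvPolynomial (Fin 3) R} (hG : G.IsWeightedHomogeneous w n) :
    eval c G - eval (shiftZ c t) G ∈ weightedIdealW c w (n + 1) := by
  classical
  have hWeq : ∀ ρ, weightedIdealW (shiftZ c t) w ρ = weightedIdealW c w ρ := by
    intro ρ
    have := weightedIdealW_shift_z (c 0) (c 1) (c 2) t w ht'' ht' ρ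
    rw [eta_fin_three] at this; exact this
  rw [G.as_sum, map_sum, map_sum, ← Finset.sum_sub_distrib]
  refine Ideal.sum_mem _ fun m hm => ?_
  rw [eval_monomial_eq_monom3, eval_monomial_eq_monom3, ← mul_sub]
  refine Ideal.mul_mem_left _ _ ?_
  have hwm : Finsupp.weight w m = n := hG (mem_support_iff.mp hm)
  -- `c^m − c′^m = (c₀^{m₀} − (c₀ + t)^{m₀}) u^a`
  have hsplit : monom3 c m - monom3 (shiftZ c t) m =
      (c 0 ^ m 0 - (c 0 + t) ^ m 0) * (c 1 ^ m 1 * c 2 ^ m 2) := by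
    simp only [monom3, shiftZ_zero, shiftZ_one, shiftZ_two]; ring
  rw [hsplit]
  have hwt : n = m 0 * w 0 + (m 1 * w 1 + m 2 * w 2) := by
    rw [← hwm, Finsupp.weight_apply, Finsupp.sum_fintype _ _ (by simp)]
    simp [Fin.sum_univ_three]; ring
  -- the power difference
  have hpow : c 0 ^ m 0 - (c 0 + t) ^ m 0 ∈ weightedIdealW c w (m 0 * w 0 + 1) := by
    rcases Nat.eq_zero_or_pos (m 0) with h0 | hpos
    · rw [h0, pow_zero, pow_zero, sub_self]; exact Ideal.zero_mem _
    · obtain ⟨k, hk⟩ : ∃ k, m 0 = k + 1 := ⟨m 0 - 1, by omega⟩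
      have key := (Commute.all (c 0) (c 0 + t)).geom_sum₂_mul (m 0)
      -- `Σ c₀^i (c₀+t)^{m₀-1-i} · (c₀ − (c₀ + t)) = c₀^{m₀} − (c₀+t)^{m₀}`
      rw [← key]
      have hsum : (Finset.range (m 0)).sum (fun i => c 0 ^ i * (c 0 + t) ^ (m 0 - 1 - i)) ∈
          weightedIdealW c w (k * w 0) := by
        refine Ideal.sum_mem _ fun i hi => ?_
        have hi' := Finset.mem_range.mp hi
        have h1 : c 0 ^ i ∈ weightedIdealW c w (i * w 0) :=
          pow_mem_weightedIdealW c w (apply_mem_weightedIdealW c w 0) i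
        have h2 : (c 0 + t) ^ (m 0 - 1 - i) ∈ weightedIdealW c w ((m 0 - 1 - i) * w 0) :=
          pow_mem_weightedIdealW c w (Ideal.add_mem _ (apply_mem_weightedIdealW c w 0) ht'') _
        have := weightedIdealW_mul_le c w _ _ (Ideal.mul_mem_mul h1 h2)
        refine weightedIdealW_antitone c w ?_ this
        have : i + (m 0 - 1 - i) = k := by omega
        rw [← add_mul, this]
      have hdiff : c 0 - (c 0 + t) = -t := by ring
      rw [hdiff]
      have := weightedIdealW_mul_le c w _ _ (Ideal.mul_mem_mul hsum ((weightedIdealW c w _).neg_mem ht))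
      refine weightedIdealW_antitone c w ?_ this
      rw [hk]; ring_nf; omega
  have hu : c 1 ^ m 1 * c 2 ^ m 2 ∈ weightedIdealW c w (m 1 * w 1 + m 2 * w 2) :=
    weightedIdealW_mul_le c w _ _ (Ideal.mul_mem_mul
      (pow_mem_weightedIdealW c w (apply_mem_weightedIdealW c w 1) _)
      (pow_mem_weightedIdealW c w (apply_mem_weightedIdealW c w 2) _))
  have := weightedIdealW_mul_le c w _ _ (Ideal.mul_mem_mul hpow hu)
  refine weightedIdealW_antitone c w ?_ this
  rw [hwt]; omega

include hgen hdim in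
/-- **Vertices strictly on the near side are preserved** (CJS Lemma 11.4 (1)): if `e⋆ ∈ pts c J μ`
minimises the positive form `ℓ′ = p₁′ x₁ + p₂′ x₂` over `pts c J μ`, `ℓ′(e⋆) > 0`, and the shift
point `v` lies strictly beyond the supporting line (`L (p₁′ v₁ + p₂′ v₂) > ℓ′(e⋆)`), then `e⋆`
is a Newton point of `c′ = (y + λ u^v, u)`, for any `λ`.
[cite: CossartJannsenSaito2020, Lemma 11.4 (1)] [cite: CossartPiltant2008, §4 p. 11] -/
theorem mem_pts_shiftZ_of_isMinOn {p₁' p₂' : ℕ} (hp₁' : 0 < p₁') (hp₂' : 0 < p₂')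
    {e : Fin 3 →₀ ℕ} (he : e ∈ pts c J μ)
    (hmin : ∀ x ∈ pts c J μ, p₁' * spt₁ μ e + p₂' * spt₂ μ e ≤ p₁' * spt₁ μ x + p₂' * spt₂ μ x)
    (hpos : 0 < p₁' * spt₁ μ e + p₂' * spt₂ μ e)
    (hfar : p₁' * spt₁ μ e + p₂' * spt₂ μ e < μ.factorial * (p₁' * v₁ + p₂' * v₂)) :
    e ∈ pts c' J μ := by
  set ℓ := p₁' * spt₁ μ e + p₂' * spt₂ μ e with hℓ
  set w := levelWeight μ ℓ p₁' p₂' with hwdef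
  have hw : ∀ i, 0 < w i := levelWeight_pos hpos hp₁' hp₂'
  obtain ⟨g, hgJ, hinit⟩ := exists_isInitialTerm_levelWeight_of_isMinOn c hgen hdim hp₁' hp₂' he
    hmin hpos
  -- the shift has `w`-weight `> w 0`
  set t := shiftMon c lam v₁ v₂ with htdef
  have hwt : w 0 + 1 ≤ v₁ * w 1 + v₂ * w 2 := by
    simp only [hwdef, levelWeight_zero, levelWeight_one, levelWeight_two]
    nlinarith [hfar]
  have htmem : ∀ y : R, ∀ ρ, ρ ≤ v₁ * w 1 + v₂ * w 2 → t ∈ weightedIdealW ![y, c 1, c 2] w ρ := by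
    intro y ρ hρ
    rw [htdef, shiftMon]
    refine Ideal.mul_mem_left _ _ ?_
    have : c 1 ^ v₁ * c 2 ^ v₂ = monom3 ![y, c 1, c 2] (vexp v₁ v₂) := by simp [monom3]
    rw [this]
    refine monomial_mem_weightedIdealW _ w ?_
    rw [weight_vexp]; exact hρ
  have ht : t ∈ weightedIdealW c w (w 0 + 1) := by
    have := htmem (c 0) _ hwt; rwa [eta_fin_three] at this
  have ht'' : t ∈ weightedIdealW c w (w 0) := weightedIdealW_antitone c w (Nat.le_succ _) ht
  have ht' : t ∈ weightedIdealW (shiftZ c t) w (w 0) := htmem _ _ (by omega)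
  obtain ⟨G, hG, hGu, hGrem⟩ := hinit
  refine ⟨⟨g, hgJ, w, hw, G, hG, hGu, ?_⟩, he.2⟩
  -- `g - G(c′) = (g - G(c)) + (G(c) - G(c′)) ∈ F_{n+1}(c) = F_{n+1}(c′)`
  have hsub := eval_sub_eval_shiftZ_mem c ht ht' ht'' hG
  have hWeq : weightedIdealW (shiftZ c t) w (Finsupp.weight w e + 1) =
      weightedIdealW c w (Finsupp.weight w e + 1) := by
    have := weightedIdealW_shift_z (c 0) (c 1) (c 2) t w ht'' ht' (Finsupp.weight w e + 1)
    rw [eta_fin_three] at this; exact this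
  rw [hWeq]
  have : g - eval (shiftZ c t) G = (g - eval c G) + (eval c G - eval (shiftZ c t) G) := by ring
  rw [this]
  exact Ideal.add_mem _ hGrem hsub

end Regular

end Literature.AlgebraicGeometry.Resolution
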